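import Mathlib
import HarnessLib
import Summits.CriticalPhenomena.PercolationContinuityZ3.Theses.PercTreeValue
import Literature.Probability.Percolation.TwoPointFunction
import Literature.Probability.Percolation.ClusterBoundary
import Literature.Probability.Percolation.FiniteEnergy
import Literature.Probability.Percolation.BondPercolationSymmetry
import Literature.Probability.Percolation.RSW

/-!
# Line `SketchIdeator2` — skeleton for crux `TetrahedronDisjointCoexistence` (stmt-CriticalPhenomena-7798)

Lead: prover-line-stmt-CriticalPhenomena-7798-0 (rev 1, 2026-08-16). Reshaped from the planners'
`Cruxes/TetrahedronDisjointCoexistence/SketchIdeator2.lean` (ideator 2, cards `confinement-squaring` ⊇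
`halfspace-roof-avoidance`, companion `bridge-seam-switching`). Every `stub_*` is DEF-FREE over tree
declarations so that workers land them verbatim under `Theorems/`.

Route `PercTreeValue`, crux (rank 2):
`TetrahedronDisjointCoexistence : ∃ δ > 0, ∃ r₀, ∀ r ≥ r₀, δ · τ(0,a_r) · τ(b_r,c_r) ≤ P_{p_c}(0 ↔ a_r, b_r ↔ c_r, 0 ↮ b_r)`
with `a_r = (r,r,0)`, `b_r = (r,0,r)`, `c_r = (0,r,r)` (`![..] : Site 3`), `P = bondPercolation (zdGraph 3) (criticalProbI 3)`.

OBJECTS (prose abbreviations only; the stubs spell them out):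
* `H_r := {x | 2·x₂ + 2 ≤ r}` (lower half-space, roof at height `⌊(r-2)/2⌋`), `U_r := {x | r + 2 ≤ 2·x₂}` (its image under
  the rotoreflection `φ_r(x) = (r − x₁, x₀, r − x₂)` of `T_r`, `φ_r : 0 ↦ b_r, a_r ↦ c_r`);
* `Conf(R; x, y) := {ω | y ∈ C_ω(x) ∧ C_ω(x) ⊆ R}` (whole-cluster confinement);
* `D_r := openConn 0 a_r ∩ openConn b_r c_r ∩ (openConn 0 b_r)ᶜ` (the crux event, verbatim).

THE LINE (confinement squaring; composition path = S1 + S2 + S3):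
* `stub_confineProduct` (S1, provable now, M): disjoint LATTICE-edge supports ⇒ the two confinement events are
  independent (`bondPercolation_real_inter_of_disjoint` after restricting configurations to lattice edges,
  `ae_subset_edgeSet`) and their intersection lies in the disjoint-coexistence event.
* `stub_pairSymm` (S2, provable now, M): `φ_r` is an automorphism of `zdGraph 3`; `bondPercolation_real_preimage_relabel_iso`
  gives `τ(b_r,c_r) = τ(0,a_r)` and `P(Conf(U_r; b_r, c_r)) = P(Conf(H_r; 0, a_r))`.
* `stub_confinementPositivity` (S3, OPEN — the card's transfer `C⁺ = (Conf)`, lead): `P(Conf(H_r; 0, a_r)) ≥ c · τ(0, a_r)`.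
* `TetrahedronDisjointCoexistence_of`: `δ = c²`, `r₀ ↦ max r₀ 1`; `lower_upper_edges_disjoint` (proved here).
OFF-PATH STUBS (provable now; the other exact reductions of the two cards, banked as `--supports`):
* `stub_markov` (S4): `Σ'_S 1{a ∈ S, b, c ∉ S} P(K_o = S) P(b ↔ c off S) ≤ P(o ↔ a, b ↔ c, o ↮ b)` (Markov form (M)).
* `stub_switch` (S5): single-edge switching identity `(1-p) P(e ∈ ω, ω ∈ M, ω∖e ∈ D) = p P(e ∉ ω, ω ∪ e ∈ M, ω ∈ D)`.
* `stub_confOfResNoRoof` (S6): `P(0 ↔_{H_r} a, 0 ↮_{H_r} roof) ≤ P(Conf(H_r; 0, a))` ((Res) ∧ (NoRoof) ⇒ (Conf)).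
* `stub_twoReplicaOfConfinement` (S8): (Conf) ⇒ (Q) with q = c² (BGN kills the finiteness conjunct). `stub_cruxOfSeamCS` (S9):
  seam Cauchy–Schwarz transfer with explicit finite, non-zero first moment.
* COMPOSITION B (S10 `stub_restrictProduct`, S11 `stub_restrictSymm` provable; S12 `stub_restrictionPositivity`,
  S13 `stub_interfaceBlocking` OPEN): `TetrahedronDisjointCoexistence_of_restriction`, δ = c₂c₁².
* `stub_twoReplica` (S7): `(P ⊗ P)(a ∈ C₁(o), c ∈ C₂(b), C₂(b) finite, C₁(o) ∩ C₂(b) = ∅) ≤ P(o ↔ a, b ↔ c, o ↮ b)` (cluster-gas form (G),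
  i.e. crux ⇐ TwoReplicaNonIntersection).

Disproof.lean: none exists for this crux at session start (payload.disproof_path absent; `ledger crux ls`: no Disproof).
Obstructions honoured by construction: S1, S2, S4–S7 hold at EVERY `p` on `ℤ³` (S4, S5, S7 on every graph), so they carry no
constant; all content sits in S3, which is false on trees and in every jump world (as the crux must be).
-/

noncomputable section

open MeasureTheory Filter
open Literature.Probability.Percolation Literature.Probability.LatticeModels

namespace Summit.CriticalPhenomena.PercolationContinuityZ3.Cruxes.TetrahedronDisjointCoexistence.LineSketchIdeator2

/-! ## S1 — confinement squaring (independence on disjoint lattice-edge supports) -/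

/-- S1 (provable now). If the lattice-edge supports of `R₁` and `R₂` are disjoint and `x₁ ≠ x₂`, then
`P(y₁ ∈ C(x₁) ⊆ R₁) · P(y₂ ∈ C(x₂) ⊆ R₂) ≤ P(x₁ ↔ y₁, x₂ ↔ y₂, x₁ ↮ x₂)`. -/
theorem stub_confineProduct (p : unitInterval) (R₁ R₂ : Set (Site 3)) (x₁ y₁ x₂ y₂ : Site 3)
    (hx : x₁ ≠ x₂)
    (hdisj : Disjoint (edgesTouching R₁ ∩ (zdGraph 3).edgeSet) (edgesTouching R₂ ∩ (zdGraph 3).edgeSet)) :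
    (bondPercolation (zdGraph 3) p).real {ω | y₁ ∈ openCluster ω x₁ ∧ openCluster ω x₁ ⊆ R₁} *
        (bondPercolation (zdGraph 3) p).real {ω | y₂ ∈ openCluster ω x₂ ∧ openCluster ω x₂ ⊆ R₂} ≤
      (bondPercolation (zdGraph 3) p).real
        (openConn x₁ y₁ ∩ openConn x₂ y₂ ∩ (openConn x₁ x₂)ᶜ) := by
  sorry

/-! ## S2 — the edge-swapping symmetry of `T_r` -/

/-- S2 (provable now). The rotoreflection `φ_r(x) = (r − x₁, x₀, r − x₂)` is an automorphism of `zdGraph 3` with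
`φ_r 0 = b_r`, `φ_r a_r = c_r`, `φ_r '' H_r = U_r`; hence `τ(b_r, c_r) = τ(0, a_r)` and
`P(Conf(U_r; b_r, c_r)) = P(Conf(H_r; 0, a_r))`. -/
theorem stub_pairSymm (p : unitInterval) (r : ℕ) :
    (bondPercolation (zdGraph 3) p).real
        (openConn (![(r : ℤ), 0, (r : ℤ)] : Site 3) ![0, (r : ℤ), (r : ℤ)]) =
      (bondPercolation (zdGraph 3) p).real (openConn (0 : Site 3) ![(r : ℤ), (r : ℤ), 0]) ∧
    (bondPercolation (zdGraph 3) p).real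
        {ω | (![0, (r : ℤ), (r : ℤ)] : Site 3) ∈ openCluster ω ![(r : ℤ), 0, (r : ℤ)] ∧
          openCluster ω ![(r : ℤ), 0, (r : ℤ)] ⊆ {x | (r : ℤ) + 2 ≤ 2 * x 2}} =
      (bondPercolation (zdGraph 3) p).real
        {ω | (![(r : ℤ), (r : ℤ), 0] : Site 3) ∈ openCluster ω 0 ∧
          openCluster ω 0 ⊆ {x | 2 * x 2 + 2 ≤ (r : ℤ)}} := by
  sorry

/-! ## S3 — the transfer: confinement positivity (OPEN, lead) -/

/-- S3 (OPEN — the card's transfer `C⁺ = (Conf)`): the critical cluster of `0`, conditioned on containing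
`a_r = (r,r,0)`, lies in the half-space `{x₂ ≤ r/2 − 1}` with probability `≥ c > 0`, uniformly in `r`.
Pilot MC (ideator 2, L ≤ 256): `c_{1/2}(r) = 0.0059/0.0047/0.0040/0.0034/0.0035/0.0031` at `r = 4/6/8/12/16/24`. -/
theorem stub_confinementPositivity :
    ∃ c : ℝ, 0 < c ∧ ∃ r₀ : ℕ, ∀ r : ℕ, r₀ ≤ r →
      c * tau 3 (criticalProbI 3) 0 ![(r : ℤ), (r : ℤ), 0] ≤
        (bondPercolation (zdGraph 3) (criticalProbI 3)).real
          {ω | (![(r : ℤ), (r : ℤ), 0] : Site 3) ∈ openCluster ω 0 ∧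
            openCluster ω 0 ⊆ {x | 2 * x 2 + 2 ≤ (r : ℤ)}} := by
  sorry

/-! ## S4–S7 — off-path exact reductions (provable now) -/

/-- S4 (provable now; Markov lower bound, form (M)). For finite `S ∋ a` with `b, c ∉ S`:
`{K_o = S} ∩ {b ↔ c off S} ⊆ {o ↔ a, b ↔ c, o ↮ b}`, these events are disjoint in `S` and each factorises
(`real_clusterIs_inter_offConn`). -/
theorem stub_markov {V : Type*} [Countable V] [DecidableEq V] (G : SimpleGraph V) (p : unitInterval) (o a b c : V) :
    ∑' S : Finset V,
        (if a ∈ S ∧ b ∉ S ∧ c ∉ S then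
          (bondPercolation G p).real (clusterIs o S) *
            (bondPercolation G p).real (openConnIn ((↑S : Set V)ᶜ) b c)
         else 0) ≤
      (bondPercolation G p).real (openConn o a ∩ openConn b c ∩ (openConn o b)ᶜ) := by
  sorry

/-- S5 (provable now; single-edge switching). For a lattice edge `e` and measurable events `M`, `D`:
`(1 - p) · P{e ∈ ω, ω ∈ M, ω ∖ {e} ∈ D} = p · P{e ∉ ω, insert e ω ∈ M, ω ∈ D}` — both sides are
`p (1-p) P(B)` for the event `B = {insert e ω ∈ M ∧ ω ∖ {e} ∈ D}` determined by the other edges. -/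
theorem stub_switch {V : Type*} [Countable V] (G : SimpleGraph V) (p : unitInterval) {e : Sym2 V}
    (he : e ∈ G.edgeSet) {M D : Set (BondConfig V)} (hM : MeasurableSet M) (hD : MeasurableSet D) :
    (1 - (p : ℝ)) * (bondPercolation G p).real {ω | e ∈ ω ∧ ω ∈ M ∧ ω \ {e} ∈ D} =
      (p : ℝ) * (bondPercolation G p).real {ω | e ∉ ω ∧ insert e ω ∈ M ∧ ω ∈ D} := by
  sorry

/-- S6 (provable now; (Res) ∧ (NoRoof) ⇒ (Conf) at the level of events). If `0 ↔ a` inside `H_r` and `0` is not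
joined inside `H_r` to the roof layer `{x ∈ H_r | r < 2 x₂ + 4}`, then (for lattice configurations, an a.s. event)
the whole cluster of `0` lies in `H_r`. -/
theorem stub_confOfResNoRoof (p : unitInterval) (r : ℕ) (a : Site 3) :
    (bondPercolation (zdGraph 3) p).real
        (openConnIn {x : Site 3 | 2 * x 2 + 2 ≤ (r : ℤ)} 0 a ∩
          {ω | ∀ y : Site 3, 2 * y 2 + 2 ≤ (r : ℤ) → (r : ℤ) < 2 * y 2 + 4 →
              ω ∉ openConnIn {x : Site 3 | 2 * x 2 + 2 ≤ (r : ℤ)} 0 y}) ≤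
      (bondPercolation (zdGraph 3) p).real
        {ω | a ∈ openCluster ω 0 ∧ openCluster ω 0 ⊆ {x : Site 3 | 2 * x 2 + 2 ≤ (r : ℤ)}} := by
  sorry

/-- S7 (provable now; cluster-gas / two-replica lower bound, form (G)): two INDEPENDENT configurations with
`a ∈ C₁(o)`, `c ∈ C₂(b)`, `C₂(b)` finite and `C₁(o) ∩ C₂(b) = ∅` are at most as likely as disjoint coexistence in
ONE configuration (explore `C₂(b) = S`, bound `{a ∈ C₁(o), C₁(o) ∩ S = ∅}` by `{o ↔ a off S}`, resum with S4). -/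
theorem stub_twoReplica {V : Type*} [Countable V] (G : SimpleGraph V) (p : unitInterval) (o a b c : V) :
    ((bondPercolation G p).prod (bondPercolation G p)).real
        {q | a ∈ openCluster q.1 o ∧ c ∈ openCluster q.2 b ∧ (openCluster q.2 b).Finite ∧
             Disjoint (openCluster q.1 o) (openCluster q.2 b)} ≤
      (bondPercolation G p).real (openConn o a ∩ openConn b c ∩ (openConn o b)ᶜ) := by
  sorry


/-! ## S8–S9 — second-wave off-path transfers (provable now) -/

/-- S8 (provable now; (Conf) ⇒ (Q), the card's `two_replica_of_confinement`): confinement positivity implies two-replica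
non-intersection with `q = c²`. The rectangle `Conf(H_r;0,a_r) ×ˢ (Conf(U_r;b_r,c_r) ∩ {C(b_r) finite})` lies in the
two-replica event (`H_r ∩ U_r = ∅`), its probability is the product (`Measure.prod_prod`), the finiteness conjunct is
almost sure by Barsky–Grimmett–Newman (`BarskyGrimmettNewman1991_Z3_holds`: no infinite cluster confined to a half-space at
`p_c`, transported to `U_r` by a lattice automorphism; `theta_induce_eq_real_percolatesVia`), and `stub_pairSymm` squares. -/
theorem stub_twoReplicaOfConfinement
    (hConf : ∃ c : ℝ, 0 < c ∧ ∃ r₀ : ℕ, ∀ r : ℕ, r₀ ≤ r →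
      c * tau 3 (criticalProbI 3) 0 ![(r : ℤ), (r : ℤ), 0] ≤
        (bondPercolation (zdGraph 3) (criticalProbI 3)).real
          {ω | (![(r : ℤ), (r : ℤ), 0] : Site 3) ∈ openCluster ω 0 ∧
            openCluster ω 0 ⊆ {x | 2 * x 2 + 2 ≤ (r : ℤ)}}) :
    ∃ q : ℝ, 0 < q ∧ ∃ r₀ : ℕ, ∀ r : ℕ, r₀ ≤ r →
      q * tau 3 (criticalProbI 3) 0 ![(r : ℤ), (r : ℤ), 0] *
          tau 3 (criticalProbI 3) ![(r : ℤ), 0, (r : ℤ)] ![0, (r : ℤ), (r : ℤ)] ≤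
        ((bondPercolation (zdGraph 3) (criticalProbI 3)).prod
            (bondPercolation (zdGraph 3) (criticalProbI 3))).real
          {q : BondConfig (Site 3) × BondConfig (Site 3) |
            (![(r : ℤ), (r : ℤ), 0] : Site 3) ∈ openCluster q.1 0 ∧
              (![0, (r : ℤ), (r : ℤ)] : Site 3) ∈ openCluster q.2 ![(r : ℤ), 0, (r : ℤ)] ∧
              (openCluster q.2 (![(r : ℤ), 0, (r : ℤ)] : Site 3)).Finite ∧
              Disjoint (openCluster q.1 (0 : Site 3)) (openCluster q.2 ![(r : ℤ), 0, (r : ℤ)])} := by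
  sorry

/-- S9 (provable now; the companion card's transfer `crux_of_seamCS`, with the finiteness/positivity of the first moment made
explicit). `N_r(ω)` = number of lattice edges joining `C(0)` to `C(b_r)` (the SEAM, written as a `tsum` of indicators),
`D_r` = the crux event. If on `D_r` the second moment of `N_r` is at most `C/ττ` times the square of the first moment, and the
first moment is finite and non-zero, then Cauchy–Schwarz in `L²(P|_{D_r})` gives `P(D_r) ≥ ττ / C`. -/
theorem stub_cruxOfSeamCS
    (hCS : ∃ C : ENNReal, C ≠ ⊤ ∧ ∃ r₀ : ℕ, ∀ r : ℕ, r₀ ≤ r →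
      (∫⁻ ω in (openConn (0 : Site 3) ![(r : ℤ), (r : ℤ), 0] ∩
            openConn (![(r : ℤ), 0, (r : ℤ)] : Site 3) ![0, (r : ℤ), (r : ℤ)] ∩
            (openConn (0 : Site 3) ![(r : ℤ), 0, (r : ℤ)])ᶜ),
          (∑' e : Sym2 (Site 3),
            ({e | e ∈ (zdGraph 3).edgeSet ∧ ∃ u v : Site 3, e = s(u, v) ∧ u ∈ openCluster ω 0 ∧
                v ∈ openCluster ω ![(r : ℤ), 0, (r : ℤ)]} : Set (Sym2 (Site 3))).indicator
              (fun _ => (1 : ENNReal)) e) ^ 2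
          ∂(bondPercolation (zdGraph 3) (criticalProbI 3))) *
        ENNReal.ofReal (tau 3 (criticalProbI 3) 0 ![(r : ℤ), (r : ℤ), 0] *
          tau 3 (criticalProbI 3) ![(r : ℤ), 0, (r : ℤ)] ![0, (r : ℤ), (r : ℤ)]) ≤
      C * (∫⁻ ω in (openConn (0 : Site 3) ![(r : ℤ), (r : ℤ), 0] ∩
            openConn (![(r : ℤ), 0, (r : ℤ)] : Site 3) ![0, (r : ℤ), (r : ℤ)] ∩
            (openConn (0 : Site 3) ![(r : ℤ), 0, (r : ℤ)])ᶜ),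
          (∑' e : Sym2 (Site 3),
            ({e | e ∈ (zdGraph 3).edgeSet ∧ ∃ u v : Site 3, e = s(u, v) ∧ u ∈ openCluster ω 0 ∧
                v ∈ openCluster ω ![(r : ℤ), 0, (r : ℤ)]} : Set (Sym2 (Site 3))).indicator
              (fun _ => (1 : ENNReal)) e)
          ∂(bondPercolation (zdGraph 3) (criticalProbI 3))) ^ 2 ∧
      (∫⁻ ω in (openConn (0 : Site 3) ![(r : ℤ), (r : ℤ), 0] ∩
            openConn (![(r : ℤ), 0, (r : ℤ)] : Site 3) ![0, (r : ℤ), (r : ℤ)] ∩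
            (openConn (0 : Site 3) ![(r : ℤ), 0, (r : ℤ)])ᶜ),
          (∑' e : Sym2 (Site 3),
            ({e | e ∈ (zdGraph 3).edgeSet ∧ ∃ u v : Site 3, e = s(u, v) ∧ u ∈ openCluster ω 0 ∧
                v ∈ openCluster ω ![(r : ℤ), 0, (r : ℤ)]} : Set (Sym2 (Site 3))).indicator
              (fun _ => (1 : ENNReal)) e)
          ∂(bondPercolation (zdGraph 3) (criticalProbI 3))) ≠ ⊤ ∧
      (∫⁻ ω in (openConn (0 : Site 3) ![(r : ℤ), (r : ℤ), 0] ∩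
            openConn (![(r : ℤ), 0, (r : ℤ)] : Site 3) ![0, (r : ℤ), (r : ℤ)] ∩
            (openConn (0 : Site 3) ![(r : ℤ), 0, (r : ℤ)])ᶜ),
          (∑' e : Sym2 (Site 3),
            ({e | e ∈ (zdGraph 3).edgeSet ∧ ∃ u v : Site 3, e = s(u, v) ∧ u ∈ openCluster ω 0 ∧
                v ∈ openCluster ω ![(r : ℤ), 0, (r : ℤ)]} : Set (Sym2 (Site 3))).indicator
              (fun _ => (1 : ENNReal)) e)
          ∂(bondPercolation (zdGraph 3) (criticalProbI 3))) ≠ 0) :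
    Theses.PercTreeValue.TetrahedronDisjointCoexistence := by
  sorry


/-! ## S10–S13 — composition B (restriction squaring + interface blocking; the route's foreseen split, measured
`d ≥ Res² · β ≈ 0.53² · 0.30 ≈ 0.09 ≈ 60 %` of `d` at `r/L = 1/16`, kit j018104) -/

/-- S10 (provable now): connections INSIDE two disjoint vertex sets are independent (the events are determined by the
pairs inside `R₁`, resp. `R₂`: `DCT16.determinedBy_openConnIn`, `bondPercolation_real_inter_of_disjoint`). -/
theorem stub_restrictProduct {V : Type*} [Countable V] (G : SimpleGraph V) (p : unitInterval)
    {R₁ R₂ : Set V} (hdisj : Disjoint R₁ R₂) (x₁ y₁ x₂ y₂ : V) :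
    (bondPercolation G p).real (openConnIn R₁ x₁ y₁ ∩ openConnIn R₂ x₂ y₂) =
      (bondPercolation G p).real (openConnIn R₁ x₁ y₁) * (bondPercolation G p).real (openConnIn R₂ x₂ y₂) := by
  sorry

/-- S11 (provable now): the rotoreflection `φ_r` carries `{0 ↔ a_r inside H_r}` onto `{b_r ↔ c_r inside U_r}`
(`preimage_relabel_openConnIn`, `bondPercolation_real_preimage_relabel_iso`). -/
theorem stub_restrictSymm (p : unitInterval) (r : ℕ) :
    (bondPercolation (zdGraph 3) p).real
        (openConnIn {x : Site 3 | (r : ℤ) + 2 ≤ 2 * x 2} (![(r : ℤ), 0, (r : ℤ)] : Site 3) ![0, (r : ℤ), (r : ℤ)]) =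
      (bondPercolation (zdGraph 3) p).real
        (openConnIn {x : Site 3 | 2 * x 2 + 2 ≤ (r : ℤ)} (0 : Site 3) ![(r : ℤ), (r : ℤ), 0]) := by
  sorry

/-- S12 (OPEN, world-neutral — (Res) `RestrictionPositivity` of the card): joining `0` to `a_r` inside the half-space
`H_r = {x | 2x₂ + 2 ≤ r}` (roof at depth `r/2`) costs at most a constant factor: `τ^{H_r}(0,a_r) ≥ c₁ τ(0,a_r)`.
MC: `Res = 0.53/0.52/0.51` (L=256, r=16/24/32), `0.56/0.56/0.55` (L=384, r=24/32/48), `0.52/0.51/0.48` (L=512, r=32/48/64)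
(kit j018104); ideator `0.55–0.67` at L ≤ 96. -/
theorem stub_restrictionPositivity :
    ∃ c₁ : ℝ, 0 < c₁ ∧ ∃ r₀ : ℕ, ∀ r : ℕ, r₀ ≤ r →
      c₁ * tau 3 (criticalProbI 3) 0 ![(r : ℤ), (r : ℤ), 0] ≤
        (bondPercolation (zdGraph 3) (criticalProbI 3)).real
          (openConnIn {x : Site 3 | 2 * x 2 + 2 ≤ (r : ℤ)} (0 : Site 3) ![(r : ℤ), (r : ℤ), 0]) := by
  sorry

/-- S13 (OPEN, continuity-strength — INTERFACE BLOCKING): given `0 ↔ a_r` inside `H_r` and `b_r ↔ c_r` inside `U_r`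
(independent events), the full configuration does NOT join `0` to `b_r` with conditional probability `≥ c₂`.
MC: `β = 0.32/0.28/0.19` (L=256, r=16/24/32), `0.33/0.30/0.31` (L=384, r=24/32/48), `0.13/0.15/0.20` (L=512, r=32/48/64; n=16,
noisy) (kit j018104). False in every jump world (the two restricted clusters are pieces of `C_∞`). -/
theorem stub_interfaceBlocking :
    ∃ c₂ : ℝ, 0 < c₂ ∧ ∃ r₀ : ℕ, ∀ r : ℕ, r₀ ≤ r →
      c₂ * (bondPercolation (zdGraph 3) (criticalProbI 3)).real
          (openConnIn {x : Site 3 | 2 * x 2 + 2 ≤ (r : ℤ)} (0 : Site 3) ![(r : ℤ), (r : ℤ), 0] ∩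
            openConnIn {x : Site 3 | (r : ℤ) + 2 ≤ 2 * x 2} (![(r : ℤ), 0, (r : ℤ)] : Site 3) ![0, (r : ℤ), (r : ℤ)]) ≤
        (bondPercolation (zdGraph 3) (criticalProbI 3)).real
          (openConnIn {x : Site 3 | 2 * x 2 + 2 ≤ (r : ℤ)} (0 : Site 3) ![(r : ℤ), (r : ℤ), 0] ∩
            openConnIn {x : Site 3 | (r : ℤ) + 2 ≤ 2 * x 2} (![(r : ℤ), 0, (r : ℤ)] : Site 3) ![0, (r : ℤ), (r : ℤ)] ∩
            (openConn (0 : Site 3) ![(r : ℤ), 0, (r : ℤ)])ᶜ) := by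
  sorry


/-! ## S14–S16 — the three compositions as registered transfer stubs (landed in `…Transfer.lean` / `…TransferB.lean`) -/

/-- S14 (= composition A, confinement squaring, assembled from the LANDED S1, S2): (Conf) ⇒ crux with `δ = c²`. -/
theorem stub_cruxOfConfinement
    (hConf : ∃ c : ℝ, 0 < c ∧ ∃ r₀ : ℕ, ∀ r : ℕ, r₀ ≤ r →
      c * tau 3 (criticalProbI 3) 0 ![(r : ℤ), (r : ℤ), 0] ≤
        (bondPercolation (zdGraph 3) (criticalProbI 3)).real
          {ω | (![(r : ℤ), (r : ℤ), 0] : Site 3) ∈ openCluster ω 0 ∧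
            openCluster ω 0 ⊆ {x | 2 * x 2 + 2 ≤ (r : ℤ)}}) :
    Theses.PercTreeValue.TetrahedronDisjointCoexistence := by
  sorry

/-- S15 (cluster-gas transfer, from the LANDED S7): (Q) ⇒ crux with `δ = q`. -/
theorem stub_cruxOfTwoReplica
    (hQ : ∃ q : ℝ, 0 < q ∧ ∃ r₀ : ℕ, ∀ r : ℕ, r₀ ≤ r →
      q * tau 3 (criticalProbI 3) 0 ![(r : ℤ), (r : ℤ), 0] *
          tau 3 (criticalProbI 3) ![(r : ℤ), 0, (r : ℤ)] ![0, (r : ℤ), (r : ℤ)] ≤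
        ((bondPercolation (zdGraph 3) (criticalProbI 3)).prod
            (bondPercolation (zdGraph 3) (criticalProbI 3))).real
          {q : BondConfig (Site 3) × BondConfig (Site 3) |
            (![(r : ℤ), (r : ℤ), 0] : Site 3) ∈ openCluster q.1 0 ∧
              (![0, (r : ℤ), (r : ℤ)] : Site 3) ∈ openCluster q.2 ![(r : ℤ), 0, (r : ℤ)] ∧
              (openCluster q.2 (![(r : ℤ), 0, (r : ℤ)] : Site 3)).Finite ∧
              Disjoint (openCluster q.1 (0 : Site 3)) (openCluster q.2 ![(r : ℤ), 0, (r : ℤ)])}) :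
    Theses.PercTreeValue.TetrahedronDisjointCoexistence := by
  sorry

/-- S16 (= composition B, from the LANDED S10, S11, S2): (Res) ∧ (InterfaceBlocking) ⇒ crux with `δ = c₂ c₁²`. -/
theorem stub_cruxOfRestrictionBlocking
    (hRes : ∃ c₁ : ℝ, 0 < c₁ ∧ ∃ r₀ : ℕ, ∀ r : ℕ, r₀ ≤ r →
      c₁ * tau 3 (criticalProbI 3) 0 ![(r : ℤ), (r : ℤ), 0] ≤
        (bondPercolation (zdGraph 3) (criticalProbI 3)).real
          (openConnIn {x : Site 3 | 2 * x 2 + 2 ≤ (r : ℤ)} (0 : Site 3) ![(r : ℤ), (r : ℤ), 0]))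
    (hBlock : ∃ c₂ : ℝ, 0 < c₂ ∧ ∃ r₀ : ℕ, ∀ r : ℕ, r₀ ≤ r →
      c₂ * (bondPercolation (zdGraph 3) (criticalProbI 3)).real
          (openConnIn {x : Site 3 | 2 * x 2 + 2 ≤ (r : ℤ)} (0 : Site 3) ![(r : ℤ), (r : ℤ), 0] ∩
            openConnIn {x : Site 3 | (r : ℤ) + 2 ≤ 2 * x 2} (![(r : ℤ), 0, (r : ℤ)] : Site 3) ![0, (r : ℤ), (r : ℤ)]) ≤
        (bondPercolation (zdGraph 3) (criticalProbI 3)).real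
          (openConnIn {x : Site 3 | 2 * x 2 + 2 ≤ (r : ℤ)} (0 : Site 3) ![(r : ℤ), (r : ℤ), 0] ∩
            openConnIn {x : Site 3 | (r : ℤ) + 2 ≤ 2 * x 2} (![(r : ℤ), 0, (r : ℤ)] : Site 3) ![0, (r : ℤ), (r : ℤ)] ∩
            (openConn (0 : Site 3) ![(r : ℤ), 0, (r : ℤ)])ᶜ)) :
    Theses.PercTreeValue.TetrahedronDisjointCoexistence := by
  sorry

/-! ## Proved glue -/

/-- The lattice-edge supports of `H_r = {2x₂ + 2 ≤ r}` and `U_r = {r + 2 ≤ 2x₂}` are disjoint: an edge touching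
both would join two vertices whose heights differ by at least `2`. -/
theorem lower_upper_edges_disjoint (r : ℕ) :
    Disjoint (edgesTouching {x : Site 3 | 2 * x 2 + 2 ≤ (r : ℤ)} ∩ (zdGraph 3).edgeSet)
      (edgesTouching {x : Site 3 | (r : ℤ) + 2 ≤ 2 * x 2} ∩ (zdGraph 3).edgeSet) := by
  rw [Set.disjoint_left]
  rintro e ⟨⟨v, hve, hv⟩, he⟩ ⟨⟨w, hwe, hw⟩, -⟩
  simp only [Set.mem_setOf_eq] at hv hw
  induction e using Sym2.ind with
  | h x y =>
    rw [SimpleGraph.mem_edgeSet] at he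
    have hxy : y 2 - x 2 ≤ 1 ∧ x 2 - y 2 ≤ 1 := by
      obtain ⟨j, h | h⟩ := (zdGraph_adj_iff x y).1 he
      · rw [h]
        by_cases hj : (2 : Fin 3) = j
        · subst hj; simp
        · simp [hj]
      · rw [h]
        by_cases hj : (2 : Fin 3) = j
        · subst hj; simp
        · simp [hj]
    rw [Sym2.mem_iff] at hve hwe
    rcases hve with rfl | rfl <;> rcases hwe with rfl | rfl <;> omega

/-! ## Composition: the crux BY NAME, modulo S1–S3 -/

/-- `TetrahedronDisjointCoexistence` from confinement squaring: `δ = c²` where `c` is the confinement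
constant of S3; for `r ≥ max r₀ 1`,
`c² τ(0,a_r) τ(b_r,c_r) = (c τ(0,a_r))² ≤ P(Conf(H_r;0,a_r))² = P(Conf(H_r;0,a_r)) P(Conf(U_r;b_r,c_r)) ≤ D_r`. -/
theorem TetrahedronDisjointCoexistence_of :
    Theses.PercTreeValue.TetrahedronDisjointCoexistence := by
  unfold Theses.PercTreeValue.TetrahedronDisjointCoexistence
  obtain ⟨c, hc, r₀, h⟩ := stub_confinementPositivity
  refine ⟨c ^ 2, by positivity, max r₀ 1, fun r hr => ?_⟩
  have hr₀ : r₀ ≤ r := le_trans (le_max_left _ _) hr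
  have hr1 : 1 ≤ r := le_trans (le_max_right _ _) hr
  obtain ⟨hτ, hconf⟩ := stub_pairSymm (criticalProbI 3) r
  have h1 := h r hr₀
  have hb : (0 : Site 3) ≠ ![(r : ℤ), 0, (r : ℤ)] := by
    intro h0
    have h00 := congr_fun h0 0
    simp at h00
    omega
  have hprod := stub_confineProduct (criticalProbI 3) {x : Site 3 | 2 * x 2 + 2 ≤ (r : ℤ)}
    {x : Site 3 | (r : ℤ) + 2 ≤ 2 * x 2} 0 ![(r : ℤ), (r : ℤ), 0] ![(r : ℤ), 0, (r : ℤ)]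
    ![0, (r : ℤ), (r : ℤ)] hb (lower_upper_edges_disjoint r)
  rw [hconf] at hprod
  have hτ' : tau 3 (criticalProbI 3) ![(r : ℤ), 0, (r : ℤ)] ![0, (r : ℤ), (r : ℤ)] =
      tau 3 (criticalProbI 3) 0 ![(r : ℤ), (r : ℤ), 0] := by
    rw [tau_def, tau_def]; exact hτ
  rw [hτ']
  have hτnn : 0 ≤ tau 3 (criticalProbI 3) 0 ![(r : ℤ), (r : ℤ), 0] := tau_nonneg _ _ _
  calc c ^ 2 * tau 3 (criticalProbI 3) 0 ![(r : ℤ), (r : ℤ), 0] *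
        tau 3 (criticalProbI 3) 0 ![(r : ℤ), (r : ℤ), 0]
      = (c * tau 3 (criticalProbI 3) 0 ![(r : ℤ), (r : ℤ), 0]) *
          (c * tau 3 (criticalProbI 3) 0 ![(r : ℤ), (r : ℤ), 0]) := by ring
    _ ≤ (bondPercolation (zdGraph 3) (criticalProbI 3)).real
            {ω | (![(r : ℤ), (r : ℤ), 0] : Site 3) ∈ openCluster ω 0 ∧
              openCluster ω 0 ⊆ {x | 2 * x 2 + 2 ≤ (r : ℤ)}} *
          (bondPercolation (zdGraph 3) (criticalProbI 3)).real
            {ω | (![(r : ℤ), (r : ℤ), 0] : Site 3) ∈ openCluster ω 0 ∧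
              openCluster ω 0 ⊆ {x | 2 * x 2 + 2 ≤ (r : ℤ)}} :=
        mul_le_mul h1 h1 (by positivity) measureReal_nonneg
    _ ≤ _ := hprod


/-- The half-spaces `H_r` and `U_r` are disjoint vertex sets. -/
theorem lower_upper_disjoint (r : ℕ) :
    Disjoint {x : Site 3 | 2 * x 2 + 2 ≤ (r : ℤ)} {x : Site 3 | (r : ℤ) + 2 ≤ 2 * x 2} := by
  rw [Set.disjoint_left]
  intro x hx hx'
  simp only [Set.mem_setOf_eq] at hx hx'
  omega

/-- COMPOSITION B (the route's foreseen split, registered as an alternative to confinement squaring):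
`RestrictionPositivity` (S12, world-neutral) and `InterfaceBlocking` (S13, continuity-strength) give the crux with
`δ = c₂ c₁²`: `c₂ (c₁ τ(0,a_r)) (c₁ τ(b_r,c_r)) ≤ c₂ P(0 ↔_{H_r} a_r) P(b_r ↔_{U_r} c_r) = c₂ P(0 ↔_{H_r} a_r, b_r ↔_{U_r} c_r)
≤ P(0 ↔_{H_r} a_r, b_r ↔_{U_r} c_r, 0 ↮ b_r) ≤ D_r` (S10 independence, S11 + `stub_pairSymm` symmetry). -/
theorem TetrahedronDisjointCoexistence_of_restriction :
    Theses.PercTreeValue.TetrahedronDisjointCoexistence := by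
  unfold Theses.PercTreeValue.TetrahedronDisjointCoexistence
  obtain ⟨c₁, hc₁, r₁, h₁⟩ := stub_restrictionPositivity
  obtain ⟨c₂, hc₂, r₂, h₂⟩ := stub_interfaceBlocking
  refine ⟨c₂ * c₁ ^ 2, by positivity, max r₁ r₂, fun r hr => ?_⟩
  have hr₁ : r₁ ≤ r := le_trans (le_max_left _ _) hr
  have hr₂ : r₂ ≤ r := le_trans (le_max_right _ _) hr
  obtain ⟨hτ, -⟩ := stub_pairSymm (criticalProbI 3) r
  have hτ' : tau 3 (criticalProbI 3) ![(r : ℤ), 0, (r : ℤ)] ![0, (r : ℤ), (r : ℤ)] =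
      tau 3 (criticalProbI 3) 0 ![(r : ℤ), (r : ℤ), 0] := by
    rw [tau_def, tau_def]; exact hτ
  rw [hτ']
  have hA := h₁ r hr₁
  have hB := h₂ r hr₂
  have hind := stub_restrictProduct (zdGraph 3) (criticalProbI 3) (lower_upper_disjoint r)
    (0 : Site 3) ![(r : ℤ), (r : ℤ), 0] ![(r : ℤ), 0, (r : ℤ)] ![0, (r : ℤ), (r : ℤ)]
  rw [stub_restrictSymm] at hind
  have hτnn : 0 ≤ tau 3 (criticalProbI 3) 0 ![(r : ℤ), (r : ℤ), 0] := tau_nonneg _ _ _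
  have hincl : (bondPercolation (zdGraph 3) (criticalProbI 3)).real
      (openConnIn {x : Site 3 | 2 * x 2 + 2 ≤ (r : ℤ)} (0 : Site 3) ![(r : ℤ), (r : ℤ), 0] ∩
        openConnIn {x : Site 3 | (r : ℤ) + 2 ≤ 2 * x 2} (![(r : ℤ), 0, (r : ℤ)] : Site 3) ![0, (r : ℤ), (r : ℤ)] ∩
        (openConn (0 : Site 3) ![(r : ℤ), 0, (r : ℤ)])ᶜ) ≤
      (bondPercolation (zdGraph 3) (criticalProbI 3)).real
      (openConn 0 ![(r : ℤ), (r : ℤ), 0] ∩ openConn ![(r : ℤ), 0, (r : ℤ)] ![0, (r : ℤ), (r : ℤ)] ∩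
        (openConn (0 : Site 3) ![(r : ℤ), 0, (r : ℤ)])ᶜ) := by
    refine measureReal_mono ?_
    rintro ω ⟨⟨h1, h2⟩, h3⟩
    exact ⟨⟨openConnIn_subset_openConn _ _ _ h1, openConnIn_subset_openConn _ _ _ h2⟩, h3⟩
  calc c₂ * c₁ ^ 2 * tau 3 (criticalProbI 3) 0 ![(r : ℤ), (r : ℤ), 0] *
        tau 3 (criticalProbI 3) 0 ![(r : ℤ), (r : ℤ), 0]
      = c₂ * ((c₁ * tau 3 (criticalProbI 3) 0 ![(r : ℤ), (r : ℤ), 0]) *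
          (c₁ * tau 3 (criticalProbI 3) 0 ![(r : ℤ), (r : ℤ), 0])) := by ring
    _ ≤ c₂ * ((bondPercolation (zdGraph 3) (criticalProbI 3)).real
            (openConnIn {x : Site 3 | 2 * x 2 + 2 ≤ (r : ℤ)} (0 : Site 3) ![(r : ℤ), (r : ℤ), 0]) *
          (bondPercolation (zdGraph 3) (criticalProbI 3)).real
            (openConnIn {x : Site 3 | 2 * x 2 + 2 ≤ (r : ℤ)} (0 : Site 3) ![(r : ℤ), (r : ℤ), 0])) := by
        exact mul_le_mul_of_nonneg_left (mul_le_mul hA hA (by positivity) measureReal_nonneg) hc₂.le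
    _ = c₂ * (bondPercolation (zdGraph 3) (criticalProbI 3)).real
          (openConnIn {x : Site 3 | 2 * x 2 + 2 ≤ (r : ℤ)} (0 : Site 3) ![(r : ℤ), (r : ℤ), 0] ∩
            openConnIn {x : Site 3 | (r : ℤ) + 2 ≤ 2 * x 2} (![(r : ℤ), 0, (r : ℤ)] : Site 3) ![0, (r : ℤ), (r : ℤ)]) := by
        rw [hind]
    _ ≤ _ := hB
    _ ≤ _ := hincl

end Summit.CriticalPhenomena.PercolationContinuityZ3.Cruxes.TetrahedronDisjointCoexistence.LineSketchIdeator2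

end
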